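import Summits.CriticalPhenomena.PercolationContinuityZ3.Theorems.PercNearOneGluingNoHeavyLowerTailSahiCTCLadderThreeRowThreeChain
import HarnessLib

/-!
# `NoHeavyLowerTail` (crux stmt-CriticalPhenomena-4575), P3 lane: the row `#dbl = 3` of `(L_3)` in the TRIANGLE case

Support file (seat `prim-l12-p3`, gen 26; `--supports stmt-CriticalPhenomena-4575`).  Paper proof `prim-l12-p3/ROW3-PROOF-g26.md` §5, Case I.
THEOREM (`coeff_ladder_three_rowThree_nonneg_of_tri`): for 3-live up-sets `𝒳, 𝒵`, a profile `m ≤ 2` with doubled set `D`, `#D = 3`,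
`τ = #(lev m 1) ≥ 6`, such that `D ∈ 𝒳 ∩ 𝒵` and, for every `d ∈ D`, the two C-sets of the link at `d` (`csetL2 m d x`, `csetL2 m d x'` for
`{x,x'} = D∖d`) meet in at least two points, `[m](e_3·H − Θ_2·e_{≥3}·GF(W_3)) ≥ 0`.  This is the case in which every 2-live cube has the
α-triangle; the accounting is exact at `𝒳 = 𝒵 = H_3` (equality).  Ingredients: `…RowThreePrep` (cubes, charge), `…RowThreeSums` (triangle and
loop sums, `card_WC1_le_sum`), `…RowThreeChain` (chain bound, full points, base counts), and two counts proved here: `Σ_p #C(p) ≤ 2τ + #full`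
(`sum_card_C_le`) and `#{Q : d+Q ∈ W} ≤ C(τ,2) − 1 + [d+a+b ∈ W]` (`card_Q_le`).  Nothing is asserted about the crux.
-/

namespace Summit.CriticalPhenomena.PercolationContinuityZ3.Theorems.SahiCTCForms

open Finset MvPolynomial SahiCTCGenFun SahiCTCWeightedLYM

variable {α : Type*} [DecidableEq α] [Fintype α]

section RowThreeCaseI
variable {𝒳 𝒵 : Finset (Finset α)}

omit [DecidableEq α] [Fintype α] in
/-- `2·cH(3,n) = n² + n + 2` for `n ≥ 5`. [this work] -/
theorem two_mul_cH_three {n : ℕ} (hn : 5 ≤ n) : 2 * (cH 3 n : ℤ) = (n : ℤ) ^ 2 + n + 2 := by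
  unfold cH
  rw [show min 3 (n + 1 - 3) = 3 from by omega]
  simp only [sum_range_succ, sum_range_zero, Nat.choose_zero_right, Nat.choose_one_right, zero_add, Nat.cast_add,
    Nat.cast_one]
  have h2 : n.choose 2 * 2 = n * (n - 1) := by
    rw [Nat.choose_two_right]; exact Nat.div_mul_cancel (Nat.even_mul_pred_self n).two_dvd
  have h2' : (n.choose 2 : ℤ) * 2 = (n : ℤ) * ((n : ℤ) - 1) := by
    have h1 : 1 ≤ n := by omega
    have := congrArg (fun k : ℕ => (k : ℤ)) h2
    push_cast [Nat.cast_sub h1] at this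
    linarith
  nlinarith [h2']

/-- `Σ_{p ⊆ D pair} #{y ∈ T : y + p ∈ W} ≤ 2τ + #full` when `W ⊆ 𝒳 ∩ 𝒵`: a point of `T` extends at most two pairs unless it is full. [this work] -/
theorem sum_card_C_le {m : α →₀ ℕ} (hD : #(dbl m) = 3) (W : Finset (Finset α)) (hW : ∀ S ∈ W, S ∈ 𝒳 ∧ S ∈ 𝒵) :
    ∑ p ∈ (dbl m).powersetCard 2, #((lev m 1).filter fun y => insert y p ∈ W) ≤ 2 * #(lev m 1) + #(fullPts 𝒳 𝒵 m) := by
  have h := sum_card_bipartiteAbove_eq_sum_card_bipartiteBelow (s := (dbl m).powersetCard 2) (t := lev m 1)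
    (r := fun p y => insert y p ∈ W)
  simp only [bipartiteAbove, bipartiteBelow] at h
  rw [h]
  have hper : ∀ y ∈ lev m 1, #(((dbl m).powersetCard 2).filter fun p => insert y p ∈ W) ≤ 2 + if y ∈ fullPts 𝒳 𝒵 m then 1 else 0 :=
    fun y hy => by
    have h3 : #((dbl m).powersetCard 2) = 3 := by rw [card_powersetCard, hD]; rfl
    split_ifs with hf
    · exact (card_filter_le _ _).trans (by rw [h3])
    · rw [mem_fullPts, not_and] at hf
      have hf' := hf hy
      push Not at hf'
      obtain ⟨p, hp, hnot⟩ := hf'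
      have hsub : (((dbl m).powersetCard 2).filter fun p => insert y p ∈ W) ⊆ ((dbl m).powersetCard 2).erase p := fun p' hp' => by
        obtain ⟨hp'1, hp'2⟩ := mem_filter.1 hp'
        refine mem_erase.2 ⟨fun h => ?_, hp'1⟩
        subst h
        exact hnot (hW _ hp'2).1 (hW _ hp'2).2
      have := card_le_card hsub
      rw [card_erase_of_mem hp, h3] at this
      omega
  refine (sum_le_sum hper).trans ?_
  rw [sum_add_distrib, sum_const, smul_eq_mul, sum_boole, mul_comm]
  have : (lev m 1).filter (fun y => y ∈ fullPts 𝒳 𝒵 m) = fullPts 𝒳 𝒵 m := by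
    ext y; simp only [mem_filter, and_iff_right_iff_imp]; exact fun hy => (mem_fullPts.1 hy).1
  rw [this]
  simp

omit [Fintype α] in
/-- `#{Q ⊆ T pair : d + Q ∈ W} ≤ C(τ,2) − 1 + [d + a + b ∈ W]` for a pair `a ≠ b` of `T` (`W ⊆ 𝒳 ∩ 𝒵`). [this work] -/
theorem card_Q_le {m : α →₀ ℕ} (W : Finset (Finset α)) (hW : ∀ S ∈ W, S ∈ 𝒳 ∧ S ∈ 𝒵) (d : α) {a b : α} (ha : a ∈ lev m 1)
    (hb : b ∈ lev m 1) (hab : a ≠ b) :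
    #(((lev m 1).powersetCard 2).filter fun Q => insert d Q ∈ W) + 1 ≤
      (#(lev m 1)).choose 2 + if insert d {a, b} ∈ 𝒳 ∧ insert d {a, b} ∈ 𝒵 then 1 else 0 := by
  have hT2 : #((lev m 1).powersetCard 2) = (#(lev m 1)).choose 2 := card_powersetCard _ _
  have habm : ({a, b} : Finset α) ∈ (lev m 1).powersetCard 2 :=
    mem_powersetCard.2 ⟨insert_subset ha (singleton_subset_iff.2 hb), card_pair hab⟩
  split_ifs with h
  · have := card_filter_le ((lev m 1).powersetCard 2) (fun Q => insert d Q ∈ W); omega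
  · have hsub : (((lev m 1).powersetCard 2).filter fun Q => insert d Q ∈ W) ⊆ ((lev m 1).powersetCard 2).erase {a, b} := fun Q hQ => by
      obtain ⟨hQ1, hQ2⟩ := mem_filter.1 hQ
      refine mem_erase.2 ⟨fun hQab => ?_, hQ1⟩
      subst hQab; exact h (hW _ hQ2)
    have := card_le_card hsub
    rw [card_erase_of_mem habm] at this
    have hpos : 1 ≤ #((lev m 1).powersetCard 2) := card_pos.2 ⟨_, habm⟩
    omega

/-- **Row `#dbl = 3` of `(L_3)`, TRIANGLE case** (ROW3-PROOF §5 Case I): see the file header. [this work] -/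
theorem coeff_ladder_three_rowThree_nonneg_of_tri (h𝒳 : IsUpperSet (𝒳 : Set (Finset α))) (h𝒵 : IsUpperSet (𝒵 : Set (Finset α)))
    (hX3 : ∀ S ∈ 𝒳, 3 ≤ #S) (hZ3 : ∀ S ∈ 𝒵, 3 ≤ #S) {m : α →₀ ℕ} (hm : ∀ i, m i ≤ 2) (hD : #(dbl m) = 3)
    (hτ : 6 ≤ #(lev m 1)) (hDX : dbl m ∈ 𝒳) (hDZ : dbl m ∈ 𝒵)
    (hI : ∀ d ∈ dbl m, ∀ x ∈ (dbl m).erase d, ∀ x' ∈ (dbl m).erase d, x ≠ x' →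
      2 ≤ #(csetL2 𝒳 𝒵 m d x ∩ csetL2 𝒳 𝒵 m d x')) :
    0 ≤ (ee 3 * (PiP * gf (𝒳 ∩ 𝒵) - gf 𝒳 * gf 𝒵) -
      gf (bySize (· ≤ 3 - 1) : Finset (Finset α)) * gf (bySize (3 ≤ ·) : Finset (Finset α)) *
        gf ((𝒳 ∩ 𝒵).filter fun S => #S = 3)).coeff m := by
  set W := (𝒳 ∩ 𝒵).filter fun S => #S = 3 with hWdef
  have hW3 : ∀ w ∈ W, #w = 3 := fun w hw => (mem_filter.1 hw).2
  have hWsub : ∀ w ∈ W, w ∈ 𝒳 ∧ w ∈ 𝒵 := fun w hw => mem_inter.1 (mem_filter.1 hw).1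
  have hDW : dbl m ∈ W := mem_filter.2 ⟨mem_inter.2 ⟨hDX, hDZ⟩, hD⟩
  have hDT : Disjoint (dbl m) (lev m 1) := disjoint_dbl_lev_one m
  rw [coeff_sub, sub_nonneg]
  refine (coeff_chargeT_rowThree_le hm hD (by omega) W hW3).trans
    (le_trans ?_ (cubes_le_coeff_ee_mul_harris_rowThree h𝒳 h𝒵 hm hD))
  rw [if_pos hDW]
  -- abbreviations as facts
  set τ := #(lev m 1) with hτdef
  set n₃ := #(fullPts 𝒳 𝒵 m) with hn₃
  have hn₃τ : n₃ ≤ τ := card_filter_le _ _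
  -- (1) the 2-live cubes: triangles everywhere
  have hL2 : ∑ d ∈ dbl m, ((τ : ℤ) * (τ + 2)) ≤ ∑ d ∈ dbl m, ∑ y₀ ∈ lev m 1, kapL2 𝒳 𝒵 m d y₀ := by
    refine sum_le_sum fun d hd => ?_
    have h2 : #((dbl m).erase d) = 2 := by rw [card_erase_of_mem hd, hD]
    obtain ⟨x, hx⟩ : ((dbl m).erase d).Nonempty := card_pos.1 (by omega)
    obtain ⟨x', hx'⟩ : (((dbl m).erase d).erase x).Nonempty := card_pos.1 (by rw [card_erase_of_mem hx, h2]; norm_num)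
    exact sum_kapL2_ge_tri h𝒳 h𝒵 hX3 hZ3 hD hd hx (mem_of_mem_erase hx') (ne_of_mem_erase hx').symm hDX hDZ
      (hI d hd x hx x' (mem_of_mem_erase hx') (ne_of_mem_erase hx').symm)
  rw [sum_const, hD] at hL2
  simp only [nsmul_eq_mul, Nat.cast_ofNat] at hL2
  -- (2) the 1-live cubes: α-loops everywhere
  have hL1 : ∑ d ∈ dbl m, ((τ.choose 2 : ℕ) : ℤ) ≤ ∑ d ∈ dbl m, ∑ Q ∈ (lev m 1).powersetCard 2, kapL1 𝒳 𝒵 m d Q :=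
    sum_le_sum fun d hd => sum_kapL1_ge_alpha h𝒳 h𝒵 hX3 hZ3 hD hd hDX hDZ
  rw [sum_const, hD] at hL1
  simp only [nsmul_eq_mul, Nat.cast_ofNat] at hL1
  -- (3) the C₂-type charged sets
  have hWC2 : (#((W.filter fun w => ind w ≤ m).filter fun w => #(dbl m ∩ w) = 2) : ℤ) ≤ 2 * τ + n₃ := by
    have := (card_WC_le_sum hm W hW3).trans (sum_card_C_le hD W hWsub (𝒳 := 𝒳) (𝒵 := 𝒵))
    exact_mod_cast this
  -- (4) the charge constant
  have hΓ : 2 * (cH 3 (τ + 3) : ℤ) = ((τ : ℤ) + 3) ^ 2 + (τ + 3) + 2 := by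
    have := two_mul_cH_three (n := τ + 3) (by omega); push_cast at this; exact this
  have hT2 : ((τ.choose 2 : ℕ) : ℤ) * 2 = (τ : ℤ) * (τ - 1) := by
    have h2 : τ.choose 2 * 2 = τ * (τ - 1) := by
      rw [Nat.choose_two_right]; exact Nat.div_mul_cancel (Nat.even_mul_pred_self τ).two_dvd
    have h1 : 1 ≤ τ := by omega
    have := congrArg (fun k : ℕ => (k : ℤ)) h2
    push_cast [Nat.cast_sub h1] at this
    linarith
  -- (5) choose the base pair (a,b) and bound κ_R and the C₁-type sets
  have main : ∃ a ∈ lev m 1, ∃ b ∈ lev m 1, a ≠ b ∧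
      (2 * (4 + (#((dbl m).filter fun d => insert d {a, b} ∈ 𝒳 ∧ insert d {a, b} ∈ 𝒵) : ℤ)) ≤ 2 * kapR 𝒳 𝒵 m) ∧
      (2 ≤ n₃ → 2 * (13 + (#((dbl m).filter fun d => insert d {a, b} ∈ 𝒳 ∧ insert d {a, b} ∈ 𝒵) : ℤ)) +
        (((n₃ : ℤ) - 2) * (2 * (τ + 3) + 1) - ((n₃ : ℤ) - 2) ^ 2) ≤ 2 * kapR 𝒳 𝒵 m) := by
    by_cases h2 : 2 ≤ n₃
    · -- a, b full
      obtain ⟨a, ha⟩ : (fullPts 𝒳 𝒵 m).Nonempty := card_pos.1 (by omega)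
      obtain ⟨b, hb⟩ : ((fullPts 𝒳 𝒵 m).erase a).Nonempty := card_pos.1 (by rw [card_erase_of_mem ha]; omega)
      have hab : a ≠ b := (ne_of_mem_erase hb).symm
      have hbF : b ∈ fullPts 𝒳 𝒵 m := mem_of_mem_erase hb
      have haT : a ∈ lev m 1 := (mem_fullPts.1 ha).1
      have hbT : b ∈ lev m 1 := (mem_fullPts.1 hbF).1
      have haD : a ∉ dbl m := fun h => disjoint_left.1 hDT h haT
      have hbD : b ∉ dbl m := fun h => disjoint_left.1 hDT h hbT
      set K := insert a (insert b (dbl m)) with hK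
      have hKs : K ⊆ dbl m ∪ lev m 1 :=
        insert_subset (mem_union_right _ haT) (insert_subset (mem_union_right _ hbT) subset_union_left)
      have hbase := thirteen_le_kap_base h𝒳 h𝒵 hX3 hZ3 hD hab haD hbD hDX hDZ
        (fun d hd => full_erase_mem m hD ha hd) (fun d hd => full_erase_mem m hD hbF hd)
      have hmono := kap_le_kap_of_subset h𝒳 h𝒵 (D := (∅ : Finset α)) _ K (dbl m ∪ lev m 1) rfl hKs (disjoint_empty_left _)
      refine ⟨a, haT, b, hbT, hab, ?_, fun _ => ?_⟩
      · unfold kapR; linarith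
      · -- the chain over the remaining full points
        set l := (((fullPts 𝒳 𝒵 m).erase a).erase b).toList with hl
        have hlnd : l.Nodup := nodup_toList _
        have hlmem : ∀ y ∈ l, y ∈ ((fullPts 𝒳 𝒵 m).erase a).erase b := fun y hy => mem_toList.1 hy
        have hlen : (l.length : ℤ) = n₃ - 2 := by
          rw [hl, length_toList, card_erase_of_mem hb, card_erase_of_mem ha]
          have : 2 ≤ #(fullPts 𝒳 𝒵 m) := h2
          omega
        have hls : ∀ y ∈ l, y ∈ dbl m ∪ lev m 1 := fun y hy =>
          mem_union_right _ (mem_fullPts.1 (mem_of_mem_erase (mem_of_mem_erase (hlmem y hy)))).1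
        have hKl : Disjoint K l.toFinset := by
          rw [disjoint_left]; intro y hyK hyl
          have hy' := hlmem y (List.mem_toFinset.1 hyl)
          rcases mem_insert.1 hyK with rfl | hyK
          · exact (ne_of_mem_erase (mem_of_mem_erase hy')) rfl
          · rcases mem_insert.1 hyK with rfl | hyK
            · exact (ne_of_mem_erase hy') rfl
            · exact disjoint_left.1 hDT hyK (mem_fullPts.1 (mem_of_mem_erase (mem_of_mem_erase hy'))).1
        have htri : ∀ y ∈ l, ∀ s' : Finset α, K ⊆ s' → (#s' : ℤ) + 1 ≤ kap 𝒳 𝒵 (insert y ∅) s' := fun y hy s' hs' => by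
          rw [insert_empty_eq]
          exact full_link_triangle h𝒳 h𝒵 hX3 hZ3 hD (mem_of_mem_erase (mem_of_mem_erase (hlmem y hy)))
            (((subset_insert _ _).trans (subset_insert _ _)).trans hs')
        have hchain := two_mul_kap_core_add_le h𝒳 h𝒵 (D₀ := ∅) l hlnd hls hKs hKl (disjoint_empty_left _) htri
        have hcard : (#(dbl m ∪ lev m 1) : ℤ) = τ + 3 := by
          rw [card_union_of_disjoint hDT, hD]; push_cast; ring
        rw [hlen, hcard] at hchain
        unfold kapR; linarith
    · -- any two points of T
      obtain ⟨a, haT⟩ : (lev m 1).Nonempty := card_pos.1 (by omega)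
      obtain ⟨b, hb⟩ : ((lev m 1).erase a).Nonempty := card_pos.1 (by rw [card_erase_of_mem haT]; omega)
      have hab : a ≠ b := (ne_of_mem_erase hb).symm
      have hbT : b ∈ lev m 1 := mem_of_mem_erase hb
      have haD : a ∉ dbl m := fun h => disjoint_left.1 hDT h haT
      have hbD : b ∉ dbl m := fun h => disjoint_left.1 hDT h hbT
      have hKs : insert a (insert b (dbl m)) ⊆ dbl m ∪ lev m 1 :=
        insert_subset (mem_union_right _ haT) (insert_subset (mem_union_right _ hbT) subset_union_left)
      have hbase := four_le_kap_base h𝒳 h𝒵 hX3 hZ3 hD hab haD hbD hDX hDZ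
      have hmono := kap_le_kap_of_subset h𝒳 h𝒵 (D := (∅ : Finset α)) _ _ (dbl m ∪ lev m 1) rfl hKs (disjoint_empty_left _)
      exact ⟨a, haT, b, hbT, hab, by unfold kapR; linarith, fun h => absurd h h2⟩
  obtain ⟨a, haT, b, hbT, hab, hR4, hR13⟩ := main
  set Qd := (dbl m).filter fun d => insert d {a, b} ∈ 𝒳 ∧ insert d {a, b} ∈ 𝒵 with hQd
  -- (6) the C₁-type charged sets against the base pair
  have hWC1 : (#((W.filter fun w => ind w ≤ m).filter fun w => #(dbl m ∩ w) = 1) : ℤ) + 3 ≤ 3 * (τ.choose 2 : ℕ) + #Qd := by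
    have h1 := card_WC1_le_sum hm W hW3
    have h2 : ∀ d ∈ dbl m, #(((lev m 1).powersetCard 2).filter fun Q => insert d Q ∈ W) + 1 ≤
        τ.choose 2 + if insert d {a, b} ∈ 𝒳 ∧ insert d {a, b} ∈ 𝒵 then 1 else 0 := fun d _ => card_Q_le W hWsub d haT hbT hab
    have h3 := sum_le_sum h2
    rw [sum_add_distrib, sum_add_distrib, sum_const, sum_const, hD, smul_eq_mul, smul_eq_mul, sum_boole, ← hQd] at h3
    have h4 : #((W.filter fun w => ind w ≤ m).filter fun w => #(dbl m ∩ w) = 1) + 3 ≤ 3 * τ.choose 2 + #Qd := by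
      have h5 : ∑ d ∈ dbl m, #(((lev m 1).powersetCard 2).filter fun Q => insert d Q ∈ W) + 3 ≤ 3 * τ.choose 2 + #Qd := by
        simpa using h3
      exact le_trans (Nat.add_le_add_right h1 3) h5
    exact_mod_cast h4
  have hQd3 : (#Qd : ℤ) ≤ 3 := by have := card_filter_le (dbl m) (fun d => insert d {a, b} ∈ 𝒳 ∧ insert d {a, b} ∈ 𝒵); rw [hD] at this; exact_mod_cast this
  -- (7) conclude
  have hτ' : (6 : ℤ) ≤ τ := by exact_mod_cast hτ
  have hn₃' : (n₃ : ℤ) ≤ τ := by exact_mod_cast hn₃τ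
  have hWC2' : ((τ : ℤ) + 2) * #((W.filter fun w => ind w ≤ m).filter fun w => #(dbl m ∩ w) = 2) ≤ ((τ : ℤ) + 2) * (2 * τ + n₃) :=
    mul_le_mul_of_nonneg_left hWC2 (by linarith)
  by_cases h2 : 2 ≤ n₃
  · have hR := hR13 h2
    have h2' : (2 : ℤ) ≤ n₃ := by exact_mod_cast h2
    have hint : (0 : ℤ) ≤ ((τ : ℤ) - n₃) * ((τ : ℤ) - 7 + n₃) := mul_nonneg (sub_nonneg.2 hn₃') (by linarith)
    have e1 : ((τ : ℤ) - n₃) * ((τ : ℤ) - 7 + n₃) = (τ : ℤ) ^ 2 - 7 * τ + 7 * n₃ - (n₃ : ℤ) ^ 2 := by ring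
    have e2 : ((n₃ : ℤ) - 2) * (2 * (τ + 3) + 1) - ((n₃ : ℤ) - 2) ^ 2 = 2 * τ * n₃ + 7 * n₃ - 4 * τ - 14 - (n₃ : ℤ) ^ 2 + 4 * n₃ - 4 := by
      ring
    have e3 : ((τ : ℤ) + 2) * (2 * τ + n₃) = 2 * (τ : ℤ) ^ 2 + 4 * τ + τ * n₃ + 2 * n₃ := by ring
    have e4 : ((τ : ℤ) + 3) ^ 2 + (τ + 3) + 2 = (τ : ℤ) ^ 2 + 7 * τ + 14 := by ring
    linarith [hR, hL2, hL1, hWC2', hWC1, hΓ, hT2, hint, e1, e2, e3, e4]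
  · have h2' : (n₃ : ℤ) ≤ 1 := by push Not at h2; exact_mod_cast Nat.lt_succ_iff.1 h2
    have hn0 : (0 : ℤ) ≤ n₃ := Nat.cast_nonneg _
    have h6 : ((τ : ℤ) + 2) * (2 * τ + n₃) ≤ ((τ : ℤ) + 2) * (2 * τ + 1) := mul_le_mul_of_nonneg_left (by linarith) (by linarith)
    have hint : (0 : ℤ) ≤ ((τ : ℤ) - 6) * ((τ : ℤ) + 1) := mul_nonneg (by linarith) (by linarith)
    have e1 : ((τ : ℤ) - 6) * ((τ : ℤ) + 1) = (τ : ℤ) ^ 2 - 5 * τ - 6 := by ring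
    have e3 : ((τ : ℤ) + 2) * (2 * τ + 1) = 2 * (τ : ℤ) ^ 2 + 5 * τ + 2 := by ring
    have e4 : ((τ : ℤ) + 3) ^ 2 + (τ + 3) + 2 = (τ : ℤ) ^ 2 + 7 * τ + 14 := by ring
    linarith [hR4, hL2, hL1, hWC2', hWC1, hΓ, hT2, h6, hint, e1, e3, e4]

end RowThreeCaseI

end Summit.CriticalPhenomena.PercolationContinuityZ3.Theorems.SahiCTCForms
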